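import Literature.NumberTheory.Automorphic.IdeleClassCharacterAutConj
import Literature.NumberTheory.Automorphic.QuadraticIdelicNormLocalNorms
import Literature.NumberTheory.Automorphic.RelNormOneTorus
import Literature.NumberTheory.GaloisRepresentations.AdicCompletionUniformizer
import HarnessLib

/-!
# The `Gal(ℂ/ℚ)`-conjugate `σμ` of a conjugate symplectic automorphic character is again conjugate
# symplectic ([Liu21] §4.1–4.2: the index set of Cor. 4.20 is `Aut(ℂ)`-stable)

Topic `NumberTheory/Automorphic`; namespace `Literature.NumberTheory.Automorphic` (grouping sub-namespace
`IdeleClassGroup`, as in the companion files).  **Theorems only: no definition, no named fact, no `sorry`**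
(D-0026).  Sequel of `IdeleClassCharacterAutConj` (`IdeleClassGroup.autConj σ ψ e he hodd = σμ`, the unitary
idele class character with `(σμ)^{alg}(x) = σ(μ^{alg}(x))` on the finite ideles; its module docstring lists
"`σμ` is again conjugate SYMPLECTIC" as NOT HERE (i)), of `IdeleClassCharacterAlgebraicTwist` (`muAlg` = Liu's
`μ^{alg} = μ·|·|_E^{-1/2}`), of `ConjugateSelfDualCharacters` / `QuadraticIdelicNormLocalNorms` ([Liu21] Def. 4.1
and Remark 4.2: `IsConjugateSelfDual`, `IsConjugateOrthogonal`, `IsConjugateSymplectic`, the dichotomy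
`IsConjugateSelfDual.isConjugateOrthogonal_or_isConjugateSymplectic`, and the parities
`IsConjugateSymplectic.odd` / `IsConjugateOrthogonal.even`) and of `IdeleClassCharacterLocalFactors`
(`IdeleClassGroup.eq_of_eqOn_localUnits`: a character of `C_L` is determined by its local components).

SOURCE.  Y. Liu, *Fourier–Jacobi cycles and arithmetic relative trace formula*, Camb. J. Math. **9** (2021)
= arXiv:2102.11518 [Liu2021]; TeX source `FJcycle.tex` (md5 `6db49a74122d…`), held extraction
`paper:arxiv-2102.11518` p0018, p0022–p0023.

AS PRINTED.  Def. 4.1 (TeX ll. 1895–1902): "We say that `μ` is *conjugate self-dual* if `μ` is trivial on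
`Nm_{𝔸_E/𝔸_F} 𝔸_E^×`; *conjugate orthogonal* if `μ|_{𝔸_F^×} = 1`; *conjugate symplectic* if
`μ|_{𝔸_F^×} = μ_{E/F}`."  Remark 4.2 (ll. 1904–1913): a conjugate self-dual `μ` "is either conjugate orthogonal
or conjugate symplectic … the integers `𝔴_τ` are all even (resp. odd) if `μ` is conjugate orthogonal (resp.
conjugate symplectic)".  §4.1 (ll. 1922–1927): "`μ^{alg} ≔ μ · | |_E^{-1/2}`, which is then algebraic. Denote
by `M_μ ⊆ ℂ` the subfield generated by values `μ^{alg}(x)` for `x ∈ (𝔸_E^∞)^×`".  Cor. 4.20 (l. 2307): "the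
product is taken over representatives of `Gal(ℂ/ℚ)`-orbits of all conjugate symplectic automorphic characters
of `𝔸_E^×` of weight one" — so the SET of conjugate symplectic automorphic characters of weight one is meant to
be stable under `μ ↦ σμ`; this file proves that, on the tree's real carriers.

WHAT IS HERE (`L` a number field, `ψ, ψ' : IdeleClassGroup L →ₜ* Circle`, `σ : ℂ ≃+* ℂ`).
* § 1 **the mechanism**: `ψ[x] = μ^{alg}(x) · ‖x‖^{1/2}` (`coe_apply_mk_eq_muAlg_mul_sqrt`); hence if
  `μ'^{alg} = σ ∘ μ^{alg}` on the finite ideles (the defining relation of `σμ`, taken here as a HYPOTHESIS `hrel`)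
  then `ψ'[x] = σ(ψ[x])` at every finite idele `x` whose square-root norm `‖x‖^{1/2}` is fixed by `σ`
  (`coe_apply_mk_eq_map_of_muAlg_rel`).
* § 2 **the test vectors** (CM field `L`, `L⁺` its maximal totally real subfield): the Galois norms
  `N̄⟨u⟩_w = ⟨u⟩_w · \overline{⟨u⟩_w}` of the local ideles `⟨u⟩_w`, `u ∈ L_wˣ`, are finite ideles with
  `‖N̄⟨u⟩_w‖^{1/2} = ‖⟨u⟩_w‖ = ‖u‖_w = N(w)^n ∈ ℚ`, fixed by every `σ` (`sqrt_ideleNorm_ideleGalNorm`,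
  `map_ideleNorm_localUnits`); so `ψ'[N̄⟨u⟩_w] = σ(ψ[N̄⟨u⟩_w])` (`coe_apply_classGalNorm_localUnits_eq_map`).
* § 3 **transfer of Def. 4.1 along `hrel`**: `isConjugateSelfDual_iff_of_muAlg_rel` — `ψ` is conjugate
  self-dual iff `ψ'` is (both `ψ ∘ N̄` and `ψ' ∘ N̄` are characters of `C_L`, determined by their values on the
  `⟨u⟩_w`, `eq_of_eqOn_localUnits`); `IsConjugateSymplectic.of_muAlg_rel` — if `ψ` is conjugate symplectic and
  `ψ'` has an ∞-type that is odd at ONE place, then `ψ'` is conjugate symplectic (Remark 4.2: `ψ'` is self-dual,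
  hence orthogonal or symplectic, and orthogonal characters have even types); `IsConjugateOrthogonal.of_muAlg_rel`
  — the twin with an even place.
* § 4 **[Liu21] Cor. 4.20's index set is `Aut(ℂ)`-stable**, instantiating § 3 at lit-liu-1's `σμ`
  (`IdeleClassGroup.autConj`, `σ : ℂ ≃ₐ[ℚ] ℂ`, `L` totally complex / CM):
  **`isConjugateSymplectic_autConj`** / **`IsConjugateSymplectic.isConjugateSymplectic_autConj`** — `σμ` is
  conjugate symplectic; `isConjugateSelfDual_autConj`; **`IsConjugateSymplectic.hasWeight_autConj`** — `σμ` has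
  the same weight-one property (`autConjExp_eq_one_or_eq_neg_one` of the companion file); and the packaged
  statement `IsConjugateSymplectic.isConjugateSymplectic_and_hasWeight_one_autConj`: for `μ` conjugate
  symplectic of weight one, every `σμ` is conjugate symplectic of weight one.

NOT HERE.  (i) `Φ_{σμ} = σ ∘ Φ_μ` (the CM type of `σμ`; companion file's NOT HERE (i), second clause).
(ii) The group law `σ(τμ) = (στ)μ` (not needed for the orbit COUNT, which is `natCard_range_autConj` of the
companion file).  (iii) Anything about `d(μ,K)` (representation theory; CITE).

Proof route (ours; the print takes the stability for granted): Liu's remark that the values of `μ^{alg}` on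
`𝔸_F^{∞,×}` are `±‖·‖^{-1}`-multiples of rationals is replaced by the Galois-norm test vectors of § 2, which
avoids the idelic norm-compatibility `‖x_L‖_L = ‖x‖_{L⁺}²` (not in the tree): only `‖ȳ‖ = ‖y‖`
(`ideleNorm_galSmul`) and `‖⟨u⟩_w‖ = ‖u‖_w = N(w)^n` (`ideleNorm_localUnits`, `norm_units_eq_absNorm_zpow`) are
used, together with the tree's Remark-4.2 dichotomy.

## References

* [Liu2021] Y. Liu, *Fourier–Jacobi cycles and arithmetic relative trace formula*, Camb. J. Math. 9 (2021),
  no. 1, 1–147, arXiv:2102.11518 — Def. 4.1, Remark 4.2 (TeX ll. 1895–1913), §4.1 (ll. 1922–1927),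
  Cor. 4.20 (l. 2307).
* [Weil1956] A. Weil, *On a certain type of characters of the idèle-class group of an algebraic
  number-field*, Proc. Int. Symp. Tokyo–Nikko 1955 (1956), 1–7, §1 (conjugates of type-`A₀` characters).
* [CasselsFrohlichANT1967] J. W. S. Cassels, A. Fröhlich (eds.), *Algebraic Number Theory* (1967), Ch. VII
  (Tate) §1.1 (`‖σx‖ = ‖x‖`), Ch. II §16 (local components of the idele norm).
-/

set_option autoImplicit false

noncomputable section

open scoped NNReal
open NumberField IsDedekindDomain NumberField.InfinitePlace

namespace Literature.NumberTheory.Automorphic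

open GaloisRepresentations

namespace IdeleClassGroup

variable {L : Type} [Field L] [NumberField L]

/-! ## § 1. `ψ[x] = μ^{alg}(x) · ‖x‖^{1/2}`, and the transfer `ψ'[x] = σ(ψ[x])` along `μ'^{alg} = σ ∘ μ^{alg}` -/

section Mechanism

/-- `‖x‖^{1/2} ≠ 0` in `ℂ`. [folklore] -/
private theorem sqrt_ideleNorm_ne_zero (x : ideleGroup L) :
    ((Real.sqrt (GaloisRepresentations.ideleNorm x) : ℝ) : ℂ) ≠ 0 := by
  have h := (normSqrtCharacter L x).ne_zero
  rwa [normSqrtCharacter_apply] at h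

/-- **`μ[x] = μ^{alg}(x) · ‖x‖^{1/2}`** (the twist undone: `μ^{alg} = μ·|·|^{-1/2}`).
[cite: Liu2021, §4.1 (TeX l. 1922)] -/
theorem coe_apply_mk_eq_muAlg_mul_sqrt (ψ : IdeleClassGroup L →ₜ* Circle) (x : ideleGroup L) :
    ((ψ (x : IdeleClassGroup L) : Circle) : ℂ) =
      ((muAlg L ψ x : ℂˣ) : ℂ) * ((Real.sqrt (GaloisRepresentations.ideleNorm x) : ℝ) : ℂ) := by
  rw [coe_muAlg_apply, inv_mul_cancel_right₀ (sqrt_ideleNorm_ne_zero x)]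

/-- **Transfer of values along `μ'^{alg} = σ ∘ μ^{alg}`.**  If `μ'^{alg}(x) = σ(μ^{alg}(x))` for every idele
`x` with `x_∞ = 1` (the relation defining Liu's `σμ`, [Liu21] Cor. 4.20 / Weil 1956), then
`μ'[x] = σ(μ[x])` at every such `x` whose square-root norm `‖x‖^{1/2} ∈ ℝ ⊂ ℂ` is fixed by `σ`
(`μ[x] = μ^{alg}(x)·‖x‖^{1/2}` on both sides). [cite: Liu2021, §4.1 (TeX ll. 1922–1927) and Cor. 4.20 (l. 2307)] -/
theorem coe_apply_mk_eq_map_of_muAlg_rel {ψ ψ' : IdeleClassGroup L →ₜ* Circle} (σ : ℂ ≃+* ℂ)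
    (hrel : ∀ x : ideleGroup L, (x : AdeleRing (𝓞 L) L).1 = 1 →
      ((muAlg L ψ' x : ℂˣ) : ℂ) = σ ((muAlg L ψ x : ℂˣ) : ℂ))
    {x : ideleGroup L} (hx : (x : AdeleRing (𝓞 L) L).1 = 1)
    (hfix : σ ((Real.sqrt (GaloisRepresentations.ideleNorm x) : ℝ) : ℂ) =
      ((Real.sqrt (GaloisRepresentations.ideleNorm x) : ℝ) : ℂ)) :
    ((ψ' (x : IdeleClassGroup L) : Circle) : ℂ) = σ ((ψ (x : IdeleClassGroup L) : Circle) : ℂ) := by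
  rw [coe_apply_mk_eq_muAlg_mul_sqrt ψ' x, hrel x hx, coe_apply_mk_eq_muAlg_mul_sqrt ψ x, map_mul, hfix]

end Mechanism

/-! ## § 2. The test vectors `N̄⟨u⟩_w`: finite ideles with rational square-root norm -/

section TestVectors

variable [IsCMField L]

local notation3 "L⁺" => maximalRealSubfield L

/-- The Galois norm `N̄ y = y · ȳ` of an idele with trivial archimedean part has trivial archimedean part
(`Aut(L/L⁺)` acts on `L_∞` fixing `1`). [folklore] -/
private theorem ideleGalNorm_fst_eq_one {y : ideleGroup L} (hy : (y : AdeleRing (𝓞 L) L).1 = 1) :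
    ((AdeleRing.ideleGalNorm L⁺ L y : ideleGroup L) : AdeleRing (𝓞 L) L).1 = 1 := by
  rw [ideleGalNorm_eq_mul_complexConj_smul]
  change (y : AdeleRing (𝓞 L) L).1 * ((IsCMField.complexConj L • y : ideleGroup L) : AdeleRing (𝓞 L) L).1 = 1
  rw [hy, one_mul, AdeleRing.coe_smul_units, AdeleRing.smul_fst, hy, smul_one]

/-- **`‖N̄ y‖^{1/2} = ‖y‖`**: `‖y · ȳ‖ = ‖y‖ · ‖ȳ‖ = ‖y‖²` (`‖σ • y‖ = ‖y‖`, Cassels–Fröhlich VII §1.1).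
[cite: CasselsFrohlichANT1967, Ch. VII §1.1] -/
theorem sqrt_ideleNorm_ideleGalNorm (y : ideleGroup L) :
    Real.sqrt (GaloisRepresentations.ideleNorm (AdeleRing.ideleGalNorm L⁺ L y)) =
      GaloisRepresentations.ideleNorm y := by
  rw [ideleGalNorm_eq_mul_complexConj_smul, ← coe_ideleNorm, map_mul, ideleNorm_galSmul, NNReal.coe_mul,
    Real.sqrt_mul_self (NNReal.coe_nonneg _), coe_ideleNorm]

omit [IsCMField L] in
/-- **`‖⟨u⟩_w‖ = ‖u‖_w = N(w)^n` is rational**, hence fixed by every automorphism of `ℂ` (the idele norm of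
the local idele `⟨u⟩_w` is the normalised absolute value `‖u‖_w`, an integral power of `N(w)`).
[cite: CasselsFrohlichANT1967, Ch. II §16] -/
theorem map_ideleNorm_localUnits (σ : ℂ ≃+* ℂ) (w : HeightOneSpectrum (𝓞 L)) (u : (w.adicCompletion L)ˣ) :
    σ ((GaloisRepresentations.ideleNorm (localUnits w u) : ℝ) : ℂ) =
      ((GaloisRepresentations.ideleNorm (localUnits w u) : ℝ) : ℂ) := by
  rw [GaloisRepresentations.ideleNorm_localUnits, Ultrametric.AdicCompletion.norm_units_eq_absNorm_zpow L w u,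
    Complex.ofReal_zpow,
    Complex.ofReal_natCast, map_zpow₀, map_natCast]

/-- `‖N̄⟨u⟩_w‖^{1/2} = ‖u‖_w` is fixed by every automorphism of `ℂ`. [folklore] -/
private theorem map_sqrt_ideleNorm_ideleGalNorm_localUnits (σ : ℂ ≃+* ℂ) (w : HeightOneSpectrum (𝓞 L))
    (u : (w.adicCompletion L)ˣ) :
    σ ((Real.sqrt (GaloisRepresentations.ideleNorm (AdeleRing.ideleGalNorm L⁺ L (localUnits w u))) : ℝ) : ℂ) =
      ((Real.sqrt (GaloisRepresentations.ideleNorm (AdeleRing.ideleGalNorm L⁺ L (localUnits w u))) : ℝ) : ℂ) := by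
  rw [sqrt_ideleNorm_ideleGalNorm]
  exact map_ideleNorm_localUnits σ w u

/-- **`ψ'[N̄⟨u⟩_w] = σ(ψ[N̄⟨u⟩_w])`** along `μ'^{alg} = σ ∘ μ^{alg}`, for every finite place `w` of `L` and
`u ∈ L_wˣ`. [cite: Liu2021, §4.1 (TeX ll. 1922–1927)] -/
theorem coe_apply_classGalNorm_localUnits_eq_map {ψ ψ' : IdeleClassGroup L →ₜ* Circle} (σ : ℂ ≃+* ℂ)
    (hrel : ∀ x : ideleGroup L, (x : AdeleRing (𝓞 L) L).1 = 1 →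
      ((muAlg L ψ' x : ℂˣ) : ℂ) = σ ((muAlg L ψ x : ℂˣ) : ℂ))
    (w : HeightOneSpectrum (𝓞 L)) (u : (w.adicCompletion L)ˣ) :
    ((ψ' (classGalNorm L⁺ L (localUnits w u : IdeleClassGroup L)) : Circle) : ℂ) =
      σ ((ψ (classGalNorm L⁺ L (localUnits w u : IdeleClassGroup L)) : Circle) : ℂ) := by
  rw [classGalNorm_mk]
  exact coe_apply_mk_eq_map_of_muAlg_rel σ hrel (ideleGalNorm_fst_eq_one (localUnits_fst w u))
    (map_sqrt_ideleNorm_ideleGalNorm_localUnits σ w u)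

end TestVectors

/-! ## § 3. Transfer of [Liu21] Def. 4.1 along `μ'^{alg} = σ ∘ μ^{alg}` -/

section Transfer

variable [IsCMField L]

local notation3 "L⁺" => maximalRealSubfield L

omit [IsCMField L] in
/-- A character of `C_L` is conjugate self-dual as soon as it kills the Galois norms of the local ideles
`⟨u⟩_w` (`ψ ∘ N̄` is a character of `C_L`, determined by its local components —
`IdeleClassGroup.eq_of_eqOn_localUnits`). [cite: Liu2021, Def. 4.1 (TeX ll. 1895–1899)] -/
theorem isConjugateSelfDual_of_forall_localUnits {ψ : IdeleClassGroup L →ₜ* Circle}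
    (h : ∀ (w : HeightOneSpectrum (𝓞 L)) (u : (w.adicCompletion L)ˣ),
      ψ (classGalNorm L⁺ L (localUnits w u : IdeleClassGroup L)) = 1) :
    IsConjugateSelfDual L ψ := by
  let N : IdeleClassGroup L →ₜ* IdeleClassGroup L := ⟨classGalNorm L⁺ L, continuous_classGalNorm L⁺ L⟩
  have key : ψ.comp N = 1 := by
    refine eq_of_eqOn_localUnits L _ _ fun w u => ?_
    rw [ContinuousMonoidHom.coe_comp, ContinuousMonoidHom.coe_one, Function.comp_apply, Pi.one_apply,
      mk_apply]
    exact h w u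
  intro c
  have hc := DFunLike.congr_fun key c
  rwa [ContinuousMonoidHom.coe_comp, ContinuousMonoidHom.coe_one, Function.comp_apply, Pi.one_apply] at hc

/-- **Conjugate self-duality is transferred along `μ'^{alg} = σ ∘ μ^{alg}`**: if `μ'^{alg}(x) = σ(μ^{alg}(x))` on
the finite ideles then `μ` is conjugate self-dual iff `μ'` is ([Liu21] Def. 4.1: "trivial on
`Nm_{𝔸_E/𝔸_F} 𝔸_E^×`"; both `μ ∘ N̄` and `μ' ∘ N̄` are determined by the test vectors `N̄⟨u⟩_w`, where
`μ'[N̄⟨u⟩_w] = σ(μ[N̄⟨u⟩_w])`). [cite: Liu2021, Def. 4.1 (TeX ll. 1895–1899)] -/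
theorem isConjugateSelfDual_iff_of_muAlg_rel {ψ ψ' : IdeleClassGroup L →ₜ* Circle} (σ : ℂ ≃+* ℂ)
    (hrel : ∀ x : ideleGroup L, (x : AdeleRing (𝓞 L) L).1 = 1 →
      ((muAlg L ψ' x : ℂˣ) : ℂ) = σ ((muAlg L ψ x : ℂˣ) : ℂ)) :
    IsConjugateSelfDual L ψ ↔ IsConjugateSelfDual L ψ' := by
  constructor
  · intro h
    refine isConjugateSelfDual_of_forall_localUnits fun w u => Circle.ext ?_
    rw [coe_apply_classGalNorm_localUnits_eq_map σ hrel w u, h, Circle.coe_one, map_one]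
  · intro h
    refine isConjugateSelfDual_of_forall_localUnits fun w u => Circle.ext ?_
    have h1 := coe_apply_classGalNorm_localUnits_eq_map σ hrel w u
    rw [h, Circle.coe_one] at h1
    rw [Circle.coe_one]
    exact σ.injective (by rw [map_one]; exact h1.symm)

/-- Transfer of conjugate self-duality, forward direction. [cite: Liu2021, Def. 4.1 (TeX ll. 1895–1899)] -/
theorem IsConjugateSelfDual.of_muAlg_rel {ψ ψ' : IdeleClassGroup L →ₜ* Circle} (σ : ℂ ≃+* ℂ)
    (hrel : ∀ x : ideleGroup L, (x : AdeleRing (𝓞 L) L).1 = 1 →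
      ((muAlg L ψ' x : ℂˣ) : ℂ) = σ ((muAlg L ψ x : ℂˣ) : ℂ))
    (h : IsConjugateSelfDual L ψ) : IsConjugateSelfDual L ψ' :=
  (isConjugateSelfDual_iff_of_muAlg_rel σ hrel).1 h

/-- **Conjugate symplecticity is transferred along `μ'^{alg} = σ ∘ μ^{alg}`** ([Liu21] Remark 4.2): if `μ` is
conjugate symplectic, `μ'^{alg} = σ ∘ μ^{alg}` on the finite ideles, and `μ'` has an ∞-type `e'` that is odd
at some place, then `μ'` is conjugate symplectic — `μ'` is conjugate self-dual
(`IsConjugateSelfDual.of_muAlg_rel`), hence "either conjugate orthogonal or conjugate symplectic"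
(`IsConjugateSelfDual.isConjugateOrthogonal_or_isConjugateSymplectic`), and "the integers `𝔴_τ` are all
even … if `μ` is conjugate orthogonal" (`IsConjugateOrthogonal.even`). [cite: Liu2021, Remark 4.2 (TeX ll. 1904–1913)] -/
theorem IsConjugateSymplectic.of_muAlg_rel {ψ ψ' : IdeleClassGroup L →ₜ* Circle} (σ : ℂ ≃+* ℂ)
    (hrel : ∀ x : ideleGroup L, (x : AdeleRing (𝓞 L) L).1 = 1 →
      ((muAlg L ψ' x : ℂˣ) : ℂ) = σ ((muAlg L ψ x : ℂˣ) : ℂ))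
    (hψ : IsConjugateSymplectic L ψ) {e' : InfinitePlace L → ℤ} (he' : HasInfinityType L ψ' e')
    {w₀ : InfinitePlace L} (hodd : Odd (e' w₀)) : IsConjugateSymplectic L ψ' := by
  rcases (hψ.isConjugateSelfDual.of_muAlg_rel σ hrel).isConjugateOrthogonal_or_isConjugateSymplectic with
    ho | hs
  · exact absurd (ho.even he' w₀) (Int.not_even_iff_odd.2 hodd)
  · exact hs

/-- **Conjugate orthogonality is transferred along `μ'^{alg} = σ ∘ μ^{alg}`**, given an ∞-type of `μ'`
that is even at some place (Remark 4.2: conjugate symplectic characters have odd types).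
[cite: Liu2021, Remark 4.2 (TeX ll. 1904–1913)] -/
theorem IsConjugateOrthogonal.of_muAlg_rel {ψ ψ' : IdeleClassGroup L →ₜ* Circle} (σ : ℂ ≃+* ℂ)
    (hrel : ∀ x : ideleGroup L, (x : AdeleRing (𝓞 L) L).1 = 1 →
      ((muAlg L ψ' x : ℂˣ) : ℂ) = σ ((muAlg L ψ x : ℂˣ) : ℂ))
    (hψ : IsConjugateOrthogonal L ψ) {e' : InfinitePlace L → ℤ} (he' : HasInfinityType L ψ' e')
    {w₀ : InfinitePlace L} (heven : Even (e' w₀)) : IsConjugateOrthogonal L ψ' := by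
  rcases (hψ.isConjugateSelfDual.of_muAlg_rel σ hrel).isConjugateOrthogonal_or_isConjugateSymplectic with
    ho | hs
  · exact ho
  · exact absurd heven (Int.not_even_iff_odd.2 (hs.odd he' w₀))

end Transfer

/-! ## § 4. [Liu21] Cor. 4.20: the conjugates `σμ` are again conjugate symplectic (of weight one) -/

section AutConj

variable [IsCMField L]

/-- The values relation `(σμ)^{alg} = σ ∘ μ^{alg}` on the finite ideles, for lit-liu-1's `σμ`
(`IdeleClassGroup.autConj`), with `σ` viewed as a ring automorphism. [cite: Liu2021, §4.1 (TeX ll. 1922–1927)] -/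
theorem muAlg_rel_autConj (σ : ℂ ≃ₐ[ℚ] ℂ) {ψ : IdeleClassGroup L →ₜ* Circle} {e : InfinitePlace L → ℤ}
    (he : HasInfinityType L ψ e) (hodd : ∀ w, Odd (e w)) :
    ∀ x : ideleGroup L, (x : AdeleRing (𝓞 L) L).1 = 1 →
      ((muAlg L (autConj σ ψ e he hodd) x : ℂˣ) : ℂ) =
        (σ : ℂ ≃ₐ[ℚ] ℂ).toRingEquiv ((muAlg L ψ x : ℂˣ) : ℂ) :=
  fun _ hx => coe_muAlg_autConj_apply_of_fst_eq_one σ he hodd hx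

/-- **`σμ` is conjugate symplectic** whenever `μ` is: for `ψ = μ` conjugate symplectic with (odd) ∞-type
`e` and `σ ∈ Aut(ℂ)`, the conjugate `σμ = IdeleClassGroup.autConj σ ψ e he hodd` — the unitary character
with `(σμ)^{alg} = ^σ(μ^{alg})` — is again conjugate symplectic (§ 3 with the odd ∞-type of `σμ`,
`hasInfinityType_autConj` / `odd_autConjExp`).  This is the stability of Cor. 4.20's index set under
`Gal(ℂ/ℚ)`. [cite: Liu2021, Cor. 4.20 (TeX l. 2307) with Remark 4.2 (ll. 1904–1913)] -/
theorem isConjugateSymplectic_autConj (σ : ℂ ≃ₐ[ℚ] ℂ) {ψ : IdeleClassGroup L →ₜ* Circle}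
    (hψ : IsConjugateSymplectic L ψ) {e : InfinitePlace L → ℤ} (he : HasInfinityType L ψ e)
    (hodd : ∀ w, Odd (e w)) : IsConjugateSymplectic L (autConj σ ψ e he hodd) := by
  obtain ⟨w₀⟩ := (inferInstance : Nonempty (InfinitePlace L))
  exact hψ.of_muAlg_rel (σ : ℂ ≃ₐ[ℚ] ℂ).toRingEquiv (muAlg_rel_autConj σ he hodd)
    (hasInfinityType_autConj σ he hodd) (w₀ := w₀) (odd_autConjExp σ he hodd w₀)

/-- `σμ` is conjugate self-dual whenever `μ` is (and has an odd ∞-type, so that `σμ` is defined).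
[cite: Liu2021, Def. 4.1 and Remark 4.2 (TeX ll. 1895–1913)] -/
theorem isConjugateSelfDual_autConj (σ : ℂ ≃ₐ[ℚ] ℂ) {ψ : IdeleClassGroup L →ₜ* Circle}
    (hψ : IsConjugateSelfDual L ψ) {e : InfinitePlace L → ℤ} (he : HasInfinityType L ψ e)
    (hodd : ∀ w, Odd (e w)) : IsConjugateSelfDual L (autConj σ ψ e he hodd) :=
  hψ.of_muAlg_rel (σ : ℂ ≃ₐ[ℚ] ℂ).toRingEquiv (muAlg_rel_autConj σ he hodd)

/-- **[Liu21] Cor. 4.20: `σμ` is conjugate symplectic**, for the canonical conjugate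
`IsConjugateSymplectic.autConj` of a conjugate symplectic `μ`. [cite: Liu2021, Cor. 4.20 (TeX l. 2307) with Remark 4.2] -/
theorem IsConjugateSymplectic.isConjugateSymplectic_autConj {ψ : IdeleClassGroup L →ₜ* Circle}
    (hψ : IsConjugateSymplectic L ψ) (σ : ℂ ≃ₐ[ℚ] ℂ) : IsConjugateSymplectic L (hψ.autConj σ) :=
  IdeleClassGroup.isConjugateSymplectic_autConj σ hψ hψ.hasInfinityType_infinityType
    fun w => hψ.odd hψ.hasInfinityType_infinityType w

/-- `σμ` is conjugate self-dual (conjugate symplectic case). [cite: Liu2021, Def. 4.1 and Remark 4.2] -/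
theorem IsConjugateSymplectic.isConjugateSelfDual_autConj {ψ : IdeleClassGroup L →ₜ* Circle}
    (hψ : IsConjugateSymplectic L ψ) (σ : ℂ ≃ₐ[ℚ] ℂ) : IsConjugateSelfDual L (hψ.autConj σ) :=
  (hψ.isConjugateSymplectic_autConj σ).isConjugateSelfDual

/-- `σμ` is not conjugate orthogonal (it is conjugate symplectic; Remark 4.2 "not both").
[cite: Liu2021, Remark 4.2 (TeX ll. 1904–1913)] -/
theorem IsConjugateSymplectic.not_isConjugateOrthogonal_autConj {ψ : IdeleClassGroup L →ₜ* Circle}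
    (hψ : IsConjugateSymplectic L ψ) (σ : ℂ ≃ₐ[ℚ] ℂ) : ¬ IsConjugateOrthogonal L (hψ.autConj σ) :=
  (hψ.isConjugateSymplectic_autConj σ).not_isConjugateOrthogonal

/-- **Weight one is preserved by `μ ↦ σμ`** ([Liu21] Def. 4.3 (1), Cor. 4.20 "of weight one"): if the
conjugate symplectic `μ` has weight one then so does `σμ` (its ∞-type is `±1` at every place,
`autConjExp_eq_one_or_eq_neg_one` of the companion file). [cite: Liu2021, Def. 4.3 (1) and Cor. 4.20 (TeX ll. 1915–1917, 2307)] -/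
theorem IsConjugateSymplectic.hasWeight_autConj {ψ : IdeleClassGroup L →ₜ* Circle}
    (hψ : IsConjugateSymplectic L ψ) (h1 : HasWeight L ψ 1) (σ : ℂ ≃ₐ[ℚ] ℂ) :
    HasWeight L (hψ.autConj σ) 1 := by
  obtain ⟨e, he, hwe⟩ := h1
  have hee : hψ.infinityType = e := hψ.infinityType_eq he
  have h1' : ∀ w, hψ.infinityType w = 1 ∨ hψ.infinityType w = -1 := fun w => by
    have hw := congrFun hwe w
    rw [weight_apply, Pi.one_apply] at hw
    rw [hee]
    omega
  refine ⟨_, hasInfinityType_autConj σ hψ.hasInfinityType_infinityType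
    (fun w => hψ.odd hψ.hasInfinityType_infinityType w), funext fun w => ?_⟩
  rw [weight_apply, Pi.one_apply]
  rcases autConjExp_eq_one_or_eq_neg_one σ hψ.hasInfinityType_infinityType
      (fun w => hψ.odd hψ.hasInfinityType_infinityType w) h1' w with h | h
  · rw [h]; rfl
  · rw [h]; rfl

/-- **The index set of [Liu21] Cor. 4.20 is `Gal(ℂ/ℚ)`-stable**: for `μ` a conjugate symplectic automorphic
character of weight one and `σ ∈ Aut(ℂ)`, the conjugate `σμ` is again a conjugate symplectic automorphic
character of weight one — so "representatives of `Gal(ℂ/ℚ)`-orbits of all conjugate symplectic automorphic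
characters of `𝔸_E^×` of weight one" is meaningful for the characters themselves (the orbit of `μ` has
`[M_μ:ℚ]` elements by `IsConjugateSymplectic.natCard_range_autConj` of the companion file).
[cite: Liu2021, Cor. 4.20 (TeX ll. 2301–2314)] -/
theorem IsConjugateSymplectic.isConjugateSymplectic_and_hasWeight_one_autConj
    {ψ : IdeleClassGroup L →ₜ* Circle} (hψ : IsConjugateSymplectic L ψ) (h1 : HasWeight L ψ 1)
    (σ : ℂ ≃ₐ[ℚ] ℂ) : IsConjugateSymplectic L (hψ.autConj σ) ∧ HasWeight L (hψ.autConj σ) 1 :=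
  ⟨hψ.isConjugateSymplectic_autConj σ, hψ.hasWeight_autConj h1 σ⟩

end AutConj

end IdeleClassGroup

end Literature.NumberTheory.Automorphic

end
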